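import Literature.Computability.AlgebraicComplexity.AlmanLi2026BlockFreeLunch
import HarnessLib

/-!
# `T^{⊗2} ⊕ ⊕_α ⟨1,(d_α−1)d²,1⟩ ⊴ ⟨d,d²,d⟩ ⊕ p ⊙ ⟨1,d²,1⟩` (Alman–Li 2026, Lemma 7.2)

Topic `Literature/Computability/AlgebraicComplexity` (family `MatrixMultiplication`). Source: J. Alman,
B. Li, *Asymptotic Rank Speedup Theorems, Revisited*, arXiv:2605.21738 (2026), §7.2, Lemma 7.2 with
its printed proof (held text `paper:arxiv-2605.21738`, p. 18 L80 – p. 19 L12), read first-hand; it is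
the degeneration behind Thm. 7.2 = Thm. 1.4 (`R̃(T) ≤ sqrt(d^{4ω/3} − ⌊d/3⌋(2^{ω/3}−1)d^{2ω/3})`).

## The printed statement and proof (p. 18 L80 – p. 19 L12)

"Lemma 7.2. Let `{d_α}_{1≤α≤p}` be positive integers such that `∑_α d_α ≤ d`. Then we have degeneration
`T^{⊗2} ⊕ ⊕_{α=1}^p ⟨1,(d_α−1)d²,1⟩ ⊴ ⟨d,d²,d⟩ ⊕ p ⊙ ⟨1,d²,1⟩`.
Proof. We start from the redundant restriction `T^{⊗2} ≤ ⟨d,d²,d⟩ ⊕ p ⊙ ⟨1,d²,1⟩`. Write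
`S ≔ ⟨d,d²,d⟩ ⊕ p ⊙ ⟨1,d²,1⟩ = ∑_{i=1}^d ∑_{j=1}^{d²} ∑_{k=1}^d u_{ij} v_{jk} w_{ki} − ∑_α ∑_{ℓ=1}^{d²} u'_{αℓ} v'_{αℓ} w'_α`
… Fix a partition `[∑ d_α] = I_1 ⊔ ⋯ ⊔ I_p` where `|I_α| = d_α`. Define the linear map `C` by augmenting the
corresponding linear map of `T^{⊗2} ≤ ⟨d,d²,d⟩` by zero on new components, and `C'` by
`w_{ki} ↦ w'_α` if `i = k ∈ I_α`, `0` otherwise, `w'_α ↦ w'_α`, and choose linear maps `A, B` so that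
`0 = (A ⊗ B ⊗ C') S = ∑_α (∑_{i∈I_α} ∑_j A(u_{ij}) B(v_{ji}) − ∑_ℓ A(u'_{αℓ}) B(v'_{αℓ})) w'_α`, where the
action on the `u`- and `v`-variables is already determined (since it stems from `T^{⊗2} ≤ ⟨d,d²,d⟩`).
Since `T^{⊗2}` has dimension `d²` in each mode, we can choose `A(u'_{αℓ})` and `B(v'_{αℓ})` so that the
terms cancel. Applying (Thm. 5.1) yields a direct summand `T' = (A' ⊗ B' ⊗ C') S` …
`(id ⊗ id ⊗ C') S = ∑_α (∑_{i∈I_α} ∑_j u_{ij} v_{ji} − ∑_ℓ u'_{αℓ} v'_{αℓ}) w'_α` [each summand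
`≅ ⟨1,(d_α+1)d²,1⟩`]. Then, as in the second proof of (Thm. 6.3), after applying the contraction
`A' ⊗ B'`, each summand `⟨1,(d_α+1)d²,1⟩` restricts to `⟨1,(d_α−1)d²,1⟩`. This completes the proof."

## The form proved here (coordinates; `AlmanLi2026.lemma72`)

`T : Fin d → Fin d → Fin d → K` over a field, `T^{⊗2} = kroneckerTensor T T` (modes indexed by
`Fin d × Fin d`, so `n = m = d²`). The `d²` middle indices `j` and the `d²` slice indices `ℓ` are
indexed by PAIRS `L = Fin d × Fin d`; `⟨d,d²,d⟩` is the coordinate tensor `[J = J' ∧ w = (i,k)]` on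
`(i,J), (J',k), (i,k)` (modes `u, v, w`; `= rotate (matMulTensor K d (d·d) d)` up to `L ≃ Fin (d·d)`),
and `p ⊙ ⟨1,d²,1⟩ = blockSliceTensor K (Prod.fst : P × L → P)` (`BlockSliceTensor.lean`). Blocks: a
block map `α : Fin d → P` (a partition of ALL of `[d]` into `|P|` labelled parts `I_γ`, `d_γ = |I_γ|`
— parts may be empty, and any unused rows may be put in any part, which only enlarges the result; this
covers the printed "`∑ d_α ≤ d`"). Conclusion:
`T^{⊗2} ⊕ ⊕_γ ⟨1,(d_γ−1)d²,1⟩ ⊴ ⟨d,d²,d⟩ ⊕ ⊕_γ ⟨1,d²,1⟩`, the left family sum being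
`blockSliceTensor K Sigma.fst` on `Σ γ, Fin ((d_γ − 1)·d²)`.

Proof = the printed one, with the choices made explicit: the restriction data of
`T^{⊗2} ≤ ⟨d,d²,d⟩ = ⟨d,d,1⟩ ⊗ ⟨1,d,d⟩` (`A(u_{i,(j,j')}) = (∑_a T_{aji} x_a) ⊗ x'_{j'}`,
`B(v_{(j,j'),k}) = y_j ⊗ ∑_b T_{j'bk} y'_b`, `C(w_{ik}) = z_i ⊗ z'_k`); the cancelling choice
`A(u'_{γℓ}) = ` column `ℓ` of `N_γ = ∑_{i∈I_γ}∑_j A(u_{ij}) ⊗ B(v_{ji})`, `B(v'_{γℓ}) = e_ℓ` (possible because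
`ℓ` ranges over `d² = dim` of the second mode); the functionals `f_γ = ∑_{i∈I_γ} w_{ii}^* − w'^*_γ`
(the printed sign moved from `S` into `C'`), whose contractions `M_γ` are supported on the disjoint
row/column blocks labelled `γ` and have rank `≥ (d_γ+1)d²` (an explicit `±`-permutation submatrix);
then the block free lunch `AlmanLi2026.freeLunch_blockFunctional` (Thm. 5.1 + Prop. 5.3 blockwise) and
the monotonicity of block one-slice tensors.

## References

* J. Alman, B. Li, arXiv:2605.21738 (2026), Lemma 7.2 and its proof (§7.2, pp. 18–19). [AlmanLi2026]
-/

noncomputable section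

open scoped BigOperators

namespace Literature.Computability.AlgebraicComplexity

universe u

variable {K : Type u}

namespace AlmanLi2026

/-! ## The source `S = ⟨d,d²,d⟩ ⊕ p ⊙ ⟨1,d²,1⟩` in coordinates and sums against it -/

/-- Contracting `S = ⟨d,d²,d⟩ ⊕ ⊕_γ ⟨1,d²,1⟩` (coordinates `[J=J' ∧ w=(i,k)]` on `(i,J),(J',k),(i,k)`
and `blockSliceTensor K Prod.fst` on `P × L`) against block vectors. [cite: AlmanLi2026, Lemma 7.2 (proof: "S ≔ ⟨d,d²,d⟩ ⊕ p⊙⟨1,d²,1⟩ = ∑ u_{ij}v_{jk}w_{ki} − ∑ u'_{αℓ}v'_{αℓ}w'_α")] -/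
theorem lemma72_sum_source [CommRing K] {d : ℕ} {L P : Type} [Fintype L] [DecidableEq L]
    [Fintype P] [DecidableEq P]
    (F : (Fin d × L) ⊕ (P × L) → K) (G : (L × Fin d) ⊕ (P × L) → K) (H : (Fin d × Fin d) ⊕ P → K) :
    (∑ x, ∑ y, ∑ z, F x * G y * H z *
      directSumTensor (fun (x : Fin d × L) (y : L × Fin d) (z : Fin d × Fin d) =>
          if x.2 = y.1 ∧ z = (x.1, y.2) then (1 : K) else 0)
        (blockSliceTensor K (Prod.fst : P × L → P)) x y z) =
      (∑ i, ∑ J, ∑ k, F (Sum.inl (i, J)) * G (Sum.inl (J, k)) * H (Sum.inl (i, k))) +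
        ∑ y : P × L, F (Sum.inr y) * G (Sum.inr y) * H (Sum.inr y.1) := by
  simp only [Fintype.sum_sum_type, directSumTensor_inl, directSumTensor_inr, directSumTensor_inl_inr,
    directSumTensor_inr_inl, directSumTensor_mixed₃_inr, directSumTensor_mixed₃_inl, mul_zero,
    Finset.sum_const_zero, add_zero, zero_add]
  congr 1
  · rw [Fintype.sum_prod_type]
    refine Finset.sum_congr rfl fun i _ => Finset.sum_congr rfl fun J _ => ?_
    rw [Fintype.sum_prod_type]
    rw [Finset.sum_eq_single J (fun J' _ hJ' => by simp [Ne.symm hJ']) (by simp)]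
    refine Finset.sum_congr rfl fun k _ => ?_
    simp only [true_and, mul_ite, mul_one, mul_zero, Finset.sum_ite_eq', Finset.mem_univ, if_true]
  · refine Finset.sum_congr rfl fun y _ => ?_
    rw [Finset.sum_eq_single y (fun y' _ hy' => by simp [Ne.symm hy']) (by simp)]
    simp only [blockSliceTensor_apply, true_and, mul_ite, mul_one, mul_zero, Finset.sum_ite_eq,
      Finset.mem_univ, if_true]

/-- The contraction `M_γ = (id ⊗ id ⊗ f_γ) S` of `S = ⟨d,d²,d⟩ ⊕ ⊕_γ ⟨1,d²,1⟩` against the block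
functional `f_γ = ∑_{i ∈ I_γ} w_{ii}^* − w'^*_γ`: the identity on the pairs `(u_{iJ}, v_{Ji})`, `i ∈ I_γ`,
and `−1` on the pairs `(u'_{γℓ}, v'_{γℓ})` ("`∑_{i∈I_α}∑_j u_{ij}v_{ji} − ∑_ℓ u'_{αℓ}v'_{αℓ}`", a matrix
`≅ ⟨1,(d_α+1)d²,1⟩`). [cite: AlmanLi2026, Lemma 7.2 (proof, display for `(id ⊗ id ⊗ C')S`)] -/
theorem lemma72_contraction [CommRing K] {d : ℕ} {L P : Type} [Fintype L] [DecidableEq L]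
    [Fintype P] [DecidableEq P] (α : Fin d → P) (γ : P)
    (x : (Fin d × L) ⊕ (P × L)) (y : (L × Fin d) ⊕ (P × L)) :
    (∑ z, Sum.elim (fun z : Fin d × Fin d => if z.1 = z.2 ∧ α z.1 = γ then (1 : K) else 0)
        (fun β => if β = γ then (-1 : K) else 0) z *
      directSumTensor (fun (x : Fin d × L) (y : L × Fin d) (z : Fin d × Fin d) =>
          if x.2 = y.1 ∧ z = (x.1, y.2) then (1 : K) else 0)
        (blockSliceTensor K (Prod.fst : P × L → P)) x y z) =
      Sum.elim (fun x => Sum.elim (fun y => if x.2 = y.1 ∧ x.1 = y.2 ∧ α x.1 = γ then (1 : K) else 0)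
          (fun _ => 0) y)
        (fun x => Sum.elim (fun _ => 0) (fun y => if x = y ∧ x.1 = γ then (-1 : K) else 0) y) x := by
  rcases x with ⟨i, J⟩ | ⟨β, ℓ⟩ <;> rcases y with ⟨J', k⟩ | ⟨β', ℓ'⟩
  · simp only [Fintype.sum_sum_type, Sum.elim_inl, Sum.elim_inr, directSumTensor_inl,
      directSumTensor_mixed₃_inr, mul_zero, Finset.sum_const_zero, add_zero]
    by_cases hJ : J = J'
    · subst hJ
      simp only [true_and, mul_ite, mul_one, mul_zero, Finset.sum_ite_eq', Finset.mem_univ, if_true]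
    · simp [hJ]
  · simp
  · simp
  · simp only [Fintype.sum_sum_type, Sum.elim_inl, Sum.elim_inr, directSumTensor_inr,
      directSumTensor_mixed₃_inl, mul_zero, Finset.sum_const_zero, zero_add, blockSliceTensor_apply]
    by_cases h : (β, ℓ) = (β', ℓ')
    · rw [← h]
      simp only [true_and, mul_ite, mul_one, mul_zero]
      rw [Finset.sum_eq_single β (fun b _ hb => by simp [Ne.symm hb]) (by simp)]
      by_cases hβ : β = γ <;> simp [hβ]
    · simp [h]

/-- A matrix containing a `±1`-relabelled identity: `R M C = 1` forces `rank M ≥ |s|`. [folklore] -/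
private theorem card_le_rank_of_mul_mul_eq_one [Field K] {m n s : Type} [Fintype m] [Fintype n]
    [Fintype s] [DecidableEq s] (M : Matrix m n K) (R : Matrix s m K) (C : Matrix n s K)
    (h : R * M * C = 1) : Fintype.card s ≤ M.rank := by
  have h1 : (R * M * C).rank = Fintype.card s := by rw [h, Matrix.rank_one]
  have h2 := (Matrix.rank_mul_le_left (R * M) C).trans (Matrix.rank_mul_le_right R M)
  omega

/-- `rank M_γ ≥ (d_γ + 1)·|L|`: the pairs `(u_{iJ}, v_{Ji})`, `i ∈ I_γ`, and `(u'_{γℓ}, v'_{γℓ})` carry a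
`±1` permutation submatrix. [cite: AlmanLi2026, Lemma 7.2 (proof: "each summand ⟨1,(d_α+1)d²,1⟩")] -/
theorem lemma72_rank [Field K] {d : ℕ} {L P : Type} [Fintype L] [DecidableEq L] [Fintype P]
    [DecidableEq P] (α : Fin d → P) (γ : P) :
    (Fintype.card {i : Fin d // α i = γ} + 1) * Fintype.card L ≤
      (Matrix.of fun (x : (Fin d × L) ⊕ (P × L)) (y : (L × Fin d) ⊕ (P × L)) =>
        Sum.elim (fun x => Sum.elim (fun y => if x.2 = y.1 ∧ x.1 = y.2 ∧ α x.1 = γ then (1 : K) else 0)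
            (fun _ => 0) y)
          (fun x => Sum.elim (fun _ => 0) (fun y => if x = y ∧ x.1 = γ then (-1 : K) else 0) y) x).rank := by
  classical
  have hcard : Fintype.card (({i : Fin d // α i = γ} × L) ⊕ L) =
      (Fintype.card {i : Fin d // α i = γ} + 1) * Fintype.card L := by
    rw [Fintype.card_sum, Fintype.card_prod]; ring
  rw [← hcard]
  refine card_le_rank_of_mul_mul_eq_one _
    (Matrix.of fun (s : ({i : Fin d // α i = γ} × L) ⊕ L) (x : (Fin d × L) ⊕ (P × L)) =>
      if x = Sum.elim (fun s => Sum.inl (s.1.1, s.2)) (fun ℓ => Sum.inr (γ, ℓ)) s then (1 : K) else 0)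
    (Matrix.of fun (y : (L × Fin d) ⊕ (P × L)) (t : ({i : Fin d // α i = γ} × L) ⊕ L) =>
      Sum.elim (fun t => if y = Sum.inl (t.2, t.1.1) then (1 : K) else 0)
        (fun ℓ => if y = Sum.inr (γ, ℓ) then (-1 : K) else 0) t) ?_
  ext s t
  rw [Matrix.mul_apply]
  simp only [Matrix.mul_apply, Matrix.of_apply, ite_mul, one_mul, zero_mul, Finset.sum_ite_eq',
    Finset.mem_univ, if_true]
  rcases s with ⟨⟨i, hi⟩, J⟩ | ℓ <;> rcases t with ⟨⟨i', hi'⟩, J'⟩ | ℓ'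
  · simp only [Sum.elim_inl, mul_ite, mul_one, mul_zero, Finset.sum_ite_eq', Finset.mem_univ,
      if_true, Matrix.one_apply, Sum.inl.injEq, Prod.mk.injEq, Subtype.mk.injEq, hi, and_true]
    by_cases h1 : J = J' <;> by_cases h2 : i = i' <;> simp [h1, h2]
  · simp
  · simp
  · simp only [Sum.elim_inr, mul_ite, mul_neg, mul_one, mul_zero, Finset.sum_ite_eq',
      Finset.mem_univ, if_true, Matrix.one_apply, Sum.inr.injEq, Prod.mk.injEq, true_and]
    by_cases h : ℓ = ℓ' <;> simp [h]

/-! ## Lemma 7.2 -/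

/-- **Alman–Li 2026, Lemma 7.2, in coordinates.** For `T : Fin d → Fin d → Fin d → K` over a field
and a block map `α : Fin d → P` (parts `I_γ = α⁻¹(γ)`, `d_γ = |I_γ|`):
`T^{⊗2} ⊕ ⊕_γ ⟨1,(d_γ−1)d²,1⟩ ⊴ ⟨d,d²,d⟩ ⊕ ⊕_γ ⟨1,d²,1⟩`, with `T^{⊗2} = kroneckerTensor T T`,
`⟨d,d²,d⟩ = [J=J' ∧ w=(i,k)]` on `(i,J),(J',k),(i,k)` (`J ∈ L = Fin d × Fin d`), `⊕_γ ⟨1,d²,1⟩ =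
blockSliceTensor K (Prod.fst : P × L → P)` and `⊕_γ ⟨1,(d_γ−1)d²,1⟩ = blockSliceTensor K Sigma.fst`
on `Σ γ, Fin ((d_γ−1)·(d·d))`. Printed proof, with the cancelling choice `A(u'_{γℓ})`, `B(v'_{γℓ})`,
the functionals `f_γ = ∑_{i∈I_γ} w*_{ii} − w'*_γ`, the rank count `(d_γ+1)d² − 2d²` and the block free
lunch (`freeLunch_blockFunctional`). [cite: AlmanLi2026, Lemma 7.2] -/
theorem lemma72 [Field K] (d : ℕ) (T : Fin d → Fin d → Fin d → K) {P : Type} [Fintype P]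
    [DecidableEq P] (α : Fin d → P) :
    AlgDegeneratesTo
      (directSumTensor (fun (x : Fin d × (Fin d × Fin d)) (y : (Fin d × Fin d) × Fin d)
          (z : Fin d × Fin d) => if x.2 = y.1 ∧ z = (x.1, y.2) then (1 : K) else 0)
        (blockSliceTensor K (Prod.fst : P × (Fin d × Fin d) → P)))
      (directSumTensor (kroneckerTensor T T)
        (blockSliceTensor K (Sigma.fst :
          (Σ γ : P, Fin ((Fintype.card {i : Fin d // α i = γ} - 1) * (d * d))) → P))) := by
  classical
  -- the block free lunch with the printed data
  have h := freeLunch_blockFunctional (K := K) (P := P)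
    (S := directSumTensor (fun (x : Fin d × (Fin d × Fin d)) (y : (Fin d × Fin d) × Fin d)
          (z : Fin d × Fin d) => if x.2 = y.1 ∧ z = (x.1, y.2) then (1 : K) else 0)
        (blockSliceTensor K (Prod.fst : P × (Fin d × Fin d) → P)))
    (T := kroneckerTensor T T)
    (A := fun a => Sum.elim (fun x : Fin d × (Fin d × Fin d) =>
        T a.1 x.2.1 x.1 * (if a.2 = x.2.2 then 1 else 0))
      (fun y : P × (Fin d × Fin d) => ∑ i, if α i = y.1 then T a.1 y.2.1 i * T a.2 y.2.2 i else 0))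
    (B := fun b => Sum.elim (fun x : (Fin d × Fin d) × Fin d =>
        (if b.1 = x.1.1 then 1 else 0) * T x.1.2 b.2 x.2)
      (fun y : P × (Fin d × Fin d) => if y.2 = b then 1 else 0))
    (C₀ := fun c => Sum.elim (fun z : Fin d × Fin d => if z = c then (1 : K) else 0) (fun _ => 0))
    ?_ (fun γ => Sum.elim (fun z : Fin d × Fin d => if z.1 = z.2 ∧ α z.1 = γ then (1 : K) else 0)
      (fun β => if β = γ then (-1 : K) else 0)) ?_
    (Sum.elim (fun x => α x.1) (fun y => y.1)) (Sum.elim (fun x => α x.2) (fun y => y.1)) ?_ ?_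
  · -- shrink the blocks from `rank M_γ − 2d²` to `(d_γ − 1)·d²`
    beta_reduce at h
    have hle : ∀ γ : P, (Fintype.card {i : Fin d // α i = γ} - 1) * (d * d) ≤
        (Matrix.of fun (x : (Fin d × (Fin d × Fin d)) ⊕ (P × (Fin d × Fin d)))
            (y : ((Fin d × Fin d) × Fin d) ⊕ (P × (Fin d × Fin d))) =>
          ∑ z, Sum.elim (fun z : Fin d × Fin d => if z.1 = z.2 ∧ α z.1 = γ then (1 : K) else 0)
              (fun β => if β = γ then (-1 : K) else 0) z *
            directSumTensor (fun (x : Fin d × (Fin d × Fin d)) (y : (Fin d × Fin d) × Fin d)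
                (z : Fin d × Fin d) => if x.2 = y.1 ∧ z = (x.1, y.2) then (1 : K) else 0)
              (blockSliceTensor K (Prod.fst : P × (Fin d × Fin d) → P)) x y z).rank -
          (Fintype.card (Fin d × Fin d) + Fintype.card (Fin d × Fin d)) := by
      intro γ
      have hr := lemma72_rank (K := K) (L := Fin d × Fin d) α γ
      have hM : (Matrix.of fun (x : (Fin d × (Fin d × Fin d)) ⊕ (P × (Fin d × Fin d)))
            (y : ((Fin d × Fin d) × Fin d) ⊕ (P × (Fin d × Fin d))) =>
          ∑ z, Sum.elim (fun z : Fin d × Fin d => if z.1 = z.2 ∧ α z.1 = γ then (1 : K) else 0)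
              (fun β => if β = γ then (-1 : K) else 0) z *
            directSumTensor (fun (x : Fin d × (Fin d × Fin d)) (y : (Fin d × Fin d) × Fin d)
                (z : Fin d × Fin d) => if x.2 = y.1 ∧ z = (x.1, y.2) then (1 : K) else 0)
              (blockSliceTensor K (Prod.fst : P × (Fin d × Fin d) → P)) x y z) =
          Matrix.of fun (x : (Fin d × (Fin d × Fin d)) ⊕ (P × (Fin d × Fin d)))
            (y : ((Fin d × Fin d) × Fin d) ⊕ (P × (Fin d × Fin d))) =>
          Sum.elim (fun x => Sum.elim (fun y =>
              if x.2 = y.1 ∧ x.1 = y.2 ∧ α x.1 = γ then (1 : K) else 0) (fun _ => 0) y)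
            (fun x => Sum.elim (fun _ => 0) (fun y => if x = y ∧ x.1 = γ then (-1 : K) else 0) y) x := by
        ext x y
        exact lemma72_contraction (K := K) α γ x y
      rw [hM]
      simp only [Fintype.card_prod, Fintype.card_fin] at hr ⊢
      have e1 : (Fintype.card {i : Fin d // α i = γ} - 1) * (d * d) =
          Fintype.card {i : Fin d // α i = γ} * (d * d) - d * d := Nat.sub_one_mul _ _
      have e2 : (Fintype.card {i : Fin d // α i = γ} + 1) * (d * d) =
          Fintype.card {i : Fin d // α i = γ} * (d * d) + d * d := Nat.succ_mul _ _
      omega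
    refine h.trans_restrictsTo ((TensorRestrictsTo.refl _).directSum
      (tensorRestrictsTo_blockSliceTensor_of_comp_eq (f := id)
        (e := fun x => ⟨x.1, Fin.castLE (hle x.1) x.2⟩) ?_ Function.injective_id (fun _ => rfl)))
    rintro ⟨γ, k⟩ ⟨β, l⟩ hxy
    obtain ⟨rfl, h2⟩ := Sigma.mk.inj_iff.mp hxy
    have := Fin.castLE_injective _ (eq_of_heq h2)
    subst this
    rfl
  · -- (1) the redundant restriction `T^{⊗2} = (A ⊗ B ⊗ C)(S)`
    rintro ⟨a, a'⟩ ⟨b, b'⟩ ⟨c, c'⟩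
    rw [lemma72_sum_source]
    simp only [Sum.elim_inl, Sum.elim_inr, kroneckerTensor_apply, mul_zero, Finset.sum_const_zero,
      add_zero]
    rw [Finset.sum_eq_single c (fun i _ hi => by simp [hi]) (by simp)]
    rw [Fintype.sum_prod_type]
    rw [Finset.sum_eq_single b (fun j _ hj => by simp [Ne.symm hj]) (by simp)]
    rw [Finset.sum_eq_single a' (fun j' _ hj' => by simp [Ne.symm hj']) (by simp)]
    rw [Finset.sum_eq_single c' (fun k _ hk => by simp [hk]) (by simp)]
    simp
  · -- (2) the functionals `f_γ` kill the restriction: the cancelling choice of `A(u')`, `B(v')`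
    rintro γ ⟨a, a'⟩ ⟨b, b'⟩
    rw [lemma72_sum_source]
    simp only [Sum.elim_inl, Sum.elim_inr]
    -- second sum: `− N_γ((a,a'),(b,b'))`
    rw [Fintype.sum_prod_type, Finset.sum_eq_single γ (fun β _ hβ => by simp [hβ]) (by simp)]
    rw [Finset.sum_eq_single (b, b') (fun ℓ _ hℓ => by simp [hℓ]) (by simp)]
    -- first sum: `∑_{i ∈ I_γ} T_{abi} T_{a'b'i}`
    have h1 : ∀ i : Fin d, (∑ J : Fin d × Fin d, ∑ k : Fin d,
        T a J.1 i * (if a' = J.2 then (1 : K) else 0) * ((if b = J.1 then 1 else 0) * T J.2 b' k) *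
          (if (i, k).1 = (i, k).2 ∧ α (i, k).1 = γ then (1 : K) else 0)) =
        if α i = γ then T a b i * T a' b' i else 0 := by
      intro i
      rw [Finset.sum_eq_single (b, a') (fun J _ hJ => by
          obtain ⟨j, j'⟩ := J
          have : ¬(b = j ∧ a' = j') := fun hh => hJ (by rw [hh.1, hh.2])
          by_cases hb : b = j
          · have hj' : ¬a' = j' := fun hh => this ⟨hb, hh⟩
            simp [hj']
          · simp [hb]) (by simp)]
      rw [Finset.sum_eq_single i (fun k _ hk => by simp [Ne.symm hk]) (by simp)]
      by_cases hγ : α i = γ <;> simp [hγ]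
    simp only [h1]
    simp
  · -- (3) row supports of the `M_γ`
    intro γ x y hx
    rw [lemma72_contraction]
    rcases x with ⟨i, J⟩ | ⟨β, ℓ⟩ <;> rcases y with ⟨J', k⟩ | ⟨β', ℓ'⟩
    · simp only [Sum.elim_inl] at hx ⊢
      simp [hx]
    · simp
    · simp
    · simp only [Sum.elim_inr] at hx ⊢
      simp [hx]
  · -- (4) column supports of the `M_γ`
    intro γ x y hy
    rw [lemma72_contraction]
    rcases x with ⟨i, J⟩ | ⟨β, ℓ⟩ <;> rcases y with ⟨J', k⟩ | ⟨β', ℓ'⟩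
    · simp only [Sum.elim_inl] at hy ⊢
      have : ¬(J = J' ∧ i = k ∧ α i = γ) := fun hh => hy (by rw [← hh.2.1]; exact hh.2.2)
      simp [this]
    · simp
    · simp
    · simp only [Sum.elim_inr] at hy ⊢
      rw [if_neg]
      rintro ⟨hh1, hh2⟩
      exact hy (by rw [← (Prod.mk.inj hh1).1]; exact hh2)

end AlmanLi2026

end Literature.Computability.AlgebraicComplexity
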